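import Mathlib
import HarnessLib
import Summits.CriticalPhenomena.PercolationContinuityZ3.Theses.PercTreeValue
import Literature.Probability.Percolation.FiniteEnergy
import Literature.Probability.Percolation.BernoulliPercolation

/-!
# `stub_switch` of line `SketchIdeator2` (crux `TetrahedronDisjointCoexistence`,
# stmt-CriticalPhenomena-7798): the single-edge switching identity

Registered off-path stub `stub_switch` (S5) of the lead's skeleton
`Cruxes/TetrahedronDisjointCoexistence/Lines/SketchIdeator2.lean`, landed DEF-FREE over tree
declarations (companion card "bridge–seam switching": toggling one contact edge between the two
clusters of a disjoint-coexistence configuration costs exactly the factor `p / (1 - p)` under the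
product measure `P_p`).

Statement: for any countable graph `G`, any `p`, any edge `e` of `G` and measurable events `M`, `D`
of bond configurations,
`(1 - p) · P_p{e ∈ ω, ω ∈ M, ω ∖ {e} ∈ D} = p · P_p{e ∉ ω, insert e ω ∈ M, ω ∈ D}`.

Proof. Put `B := {ω | insert e ω ∈ M ∧ ω ∖ {e} ∈ D}`. Pointwise
`{e ∈ ω, ω ∈ M, ω ∖ {e} ∈ D} = {e ∈ ω} ∩ B` (`insert e ω = ω` when `e ∈ ω`) and
`{e ∉ ω, insert e ω ∈ M, ω ∈ D} = {e ∉ ω} ∩ B` (`ω ∖ {e} = ω` when `e ∉ ω`). The event `B` is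
measurable (preimages under the coordinatewise-measurable maps `insert e`, `· ∖ {e}`) and determined
by the edges other than `e`, while `{e ∈ ω}`, `{e ∉ ω}` are determined by `{e}`; disjoint edge sets
are independent under the product measure (`bondPercolation_real_inter_of_disjoint`,
`FiniteEnergy.lean`; Grimmett, *Percolation* (1999), §2.2), and `P_p(e ∈ ω) = p`
(`bondPercolation_cylinder`), `P_p(e ∉ ω) = 1 - p`. Both sides equal `p (1 - p) P_p(B)`.
-/

noncomputable section

namespace Summit.CriticalPhenomena.PercolationContinuityZ3.Theorems.TetrahedronDisjointCoexistence

open MeasureTheory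
open Literature.Probability.Percolation Literature.Probability.LatticeModels

/-- On `{e open}` the event `{ω ∈ M, ω ∖ {e} ∈ D}` coincides with
`B = {insert e ω ∈ M, ω ∖ {e} ∈ D}`, since `insert e ω = ω` when `e ∈ ω`. -/
theorem switch_setOf_mem_eq {V : Type*} (e : Sym2 V) (M D : Set (BondConfig V)) :
    {ω : BondConfig V | e ∈ ω ∧ ω ∈ M ∧ ω \ {e} ∈ D} =
      {ω : BondConfig V | e ∈ ω} ∩ {ω : BondConfig V | insert e ω ∈ M ∧ ω \ {e} ∈ D} := by
  ext ω
  simp only [Set.mem_setOf_eq, Set.mem_inter_iff]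
  constructor
  · rintro ⟨he, hM, hD⟩
    exact ⟨he, by rwa [Set.insert_eq_of_mem he], hD⟩
  · rintro ⟨he, hM, hD⟩
    exact ⟨he, by rwa [Set.insert_eq_of_mem he] at hM, hD⟩

/-- On `{e closed}` the event `{insert e ω ∈ M, ω ∈ D}` coincides with
`B = {insert e ω ∈ M, ω ∖ {e} ∈ D}`, since `ω ∖ {e} = ω` when `e ∉ ω`. -/
theorem switch_setOf_notMem_eq {V : Type*} (e : Sym2 V) (M D : Set (BondConfig V)) :
    {ω : BondConfig V | e ∉ ω ∧ insert e ω ∈ M ∧ ω ∈ D} =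
      {ω : BondConfig V | e ∉ ω} ∩ {ω : BondConfig V | insert e ω ∈ M ∧ ω \ {e} ∈ D} := by
  ext ω
  simp only [Set.mem_setOf_eq, Set.mem_inter_iff]
  constructor
  · rintro ⟨he, hM, hD⟩
    exact ⟨he, hM, by rwa [Set.sdiff_singleton_eq_self he]⟩
  · rintro ⟨he, hM, hD⟩
    exact ⟨he, hM, by rwa [Set.sdiff_singleton_eq_self he] at hD⟩

/-- The event `B = {insert e ω ∈ M, ω ∖ {e} ∈ D}` is determined by the edges other than `e`:
configurations agreeing off `e` have the same `insert e ·` and the same `· ∖ {e}`. -/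
theorem switch_determinedBy_compl {V : Type*} (e : Sym2 V) (M D : Set (BondConfig V)) :
    DeterminedBy {ω : BondConfig V | insert e ω ∈ M ∧ ω \ {e} ∈ D} ({e}ᶜ : Set (Sym2 V)) := by
  rw [determinedBy_iff]
  intro ω ω' h
  have hd : ω \ {e} = ω' \ {e} := by rw [Set.sdiff_eq, Set.sdiff_eq, h]
  have hi : insert e ω = insert e ω' := by
    rw [← Set.insert_sdiff_singleton, hd, Set.insert_sdiff_singleton]
  simp only [Set.mem_setOf_eq, hi, hd]

/-- The state of the edge `e` is determined by the single edge `e`. -/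
theorem switch_determinedBy_mem {V : Type*} (e : Sym2 V) :
    DeterminedBy {ω : BondConfig V | e ∈ ω} ({e} : Set (Sym2 V)) := by
  rw [determinedBy_iff]
  intro ω ω' h
  have key := Set.ext_iff.1 h e
  simp only [Set.mem_inter_iff, Set.mem_singleton_iff, and_true] at key
  exact key

/-- The event "`e` is closed" is determined by the single edge `e`. -/
theorem switch_determinedBy_notMem {V : Type*} (e : Sym2 V) :
    DeterminedBy {ω : BondConfig V | e ∉ ω} ({e} : Set (Sym2 V)) := by
  rw [determinedBy_iff]
  intro ω ω' h
  have key := Set.ext_iff.1 h e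
  simp only [Set.mem_inter_iff, Set.mem_singleton_iff, and_true] at key
  exact not_congr key

/-- The event `B = {insert e ω ∈ M, ω ∖ {e} ∈ D}` is measurable for measurable `M`, `D`: the maps
`ω ↦ insert e ω` and `ω ↦ ω ∖ {e}` are measurable (coordinatewise) for the product σ-algebra. -/
theorem switch_measurableSet {V : Type*} (e : Sym2 V) {M D : Set (BondConfig V)}
    (hM : MeasurableSet M) (hD : MeasurableSet D) :
    MeasurableSet {ω : BondConfig V | insert e ω ∈ M ∧ ω \ {e} ∈ D} := by
  have hins : Measurable fun ω : BondConfig V => insert e ω := by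
    refine measurable_set_iff.2 fun e' => ?_
    simp only [Set.mem_insert_iff]
    exact measurable_const.or (measurable_set_mem e')
  have hdel : Measurable fun ω : BondConfig V => ω \ {e} :=
    measurable_set_iff.2 fun f => (measurable_set_mem f).and measurable_const
  exact (hM.preimage hins).inter (hD.preimage hdel)

/-- `P_p(e closed) = 1 - p` for an edge `e` of `G` (complement of the one-edge marginal
`bondPercolation_cylinder`; Grimmett, *Percolation* (1999), §1.3). -/
theorem switch_real_setOf_notMem {V : Type*} (G : SimpleGraph V) (p : unitInterval) {e : Sym2 V}
    (he : e ∈ G.edgeSet) :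
    (bondPercolation G p).real {ω : BondConfig V | e ∉ ω} = 1 - (p : ℝ) := by
  have h : {ω : BondConfig V | e ∉ ω} = {ω : BondConfig V | e ∈ ω}ᶜ := rfl
  rw [h, measureReal_compl (measurableSet_mem e), probReal_univ, bondPercolation_cylinder G p he]

/-- **S5 — single-edge switching identity.** For a countable graph `G`, an edge `e` of `G` and
measurable events `M`, `D` of bond configurations,
`(1 - p) · P_p{e ∈ ω, ω ∈ M, ω ∖ {e} ∈ D} = p · P_p{e ∉ ω, insert e ω ∈ M, ω ∈ D}`:
both sides equal `p (1 - p) P_p(B)` for the event `B = {insert e ω ∈ M ∧ ω ∖ {e} ∈ D}`, which is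
determined by the edges other than `e` and hence independent of the state of `e` under the
product measure (`bondPercolation_real_inter_of_disjoint`), with `P_p(e ∈ ω) = p`,
`P_p(e ∉ ω) = 1 - p`. -/
theorem stub_switch {V : Type*} [Countable V] (G : SimpleGraph V) (p : unitInterval) {e : Sym2 V}
    (he : e ∈ G.edgeSet) {M D : Set (BondConfig V)} (hM : MeasurableSet M) (hD : MeasurableSet D) :
    (1 - (p : ℝ)) * (bondPercolation G p).real {ω | e ∈ ω ∧ ω ∈ M ∧ ω \ {e} ∈ D} =
      (p : ℝ) * (bondPercolation G p).real {ω | e ∉ ω ∧ insert e ω ∈ M ∧ ω ∈ D} := by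
  have hB := switch_determinedBy_compl e M D
  have hBm := switch_measurableSet e hM hD
  rw [switch_setOf_mem_eq, switch_setOf_notMem_eq,
    bondPercolation_real_inter_of_disjoint G p disjoint_compl_right (switch_determinedBy_mem e) hB
      (measurableSet_mem e) hBm,
    bondPercolation_real_inter_of_disjoint G p disjoint_compl_right (switch_determinedBy_notMem e)
      hB (measurableSet_notMem e) hBm,
    bondPercolation_cylinder G p he, switch_real_setOf_notMem G p he]
  ring

end Summit.CriticalPhenomena.PercolationContinuityZ3.Theorems.TetrahedronDisjointCoexistence

end
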